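import Summits.CriticalPhenomena.PercolationContinuityZ3.Theorems.PercNearOneGluingNoHeavyConstsPinnedBinding
import Summits.CriticalPhenomena.PercolationContinuityZ3.Theorems.PercNearOneGluingNoHeavyConstsCrossReachMarkerPinnedEdgeExchanges
import HarnessLib

/-!
# The pinned-binding conjecture at level zero, `Consts.PinnedBinding₀` (the repaired form of `Consts.PinnedBinding`), and the reductions re-landed on it
# (PAPER-2 track (ii): constants of the CSH family; seat `prim-consts-2`, gen 25)

builds on p205010 (kernel theorem, internal audit signed; external expert review pending).  Support file (`--supports
stmt-CriticalPhenomena-4575`); memos `run/shared/lean/prim/consts/FROM-prim-consts-2-g24-CYLINDER-EVENTS.md` §0(2),(5) and the referee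
reports `prim-consts-3/g117/REFEREE-g117.md`, `g120/REFEREE-g120.md`.  Two definitions (an instance-local predicate and a typed conjecture),
four theorems; no sorries; standard axioms.

WHY THIS FILE.  `Consts.PinnedBinding` (…ConstsPinnedBinding.lean, p379027) asserted the binding property for EVERY level `m`; that `∀ m` form is
FALSE (`Consts.PinnedBindingCex.not_pinnedBinding`, …ConstsPinnedBindingRefutation{Witness,}.lean: an exact `n = 7` witness, just above `θ_pin`, where a
non-pinned single-pair cylinder overtakes the pinned minimiser).  Its only consumer, `Consts.crossM2_of_pinnedBinding`, used the level `m = 0` alone.  Here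
the conjecture is RETYPED at level zero and made INSTANCE-LOCAL, and both consumers are re-landed on the repaired statement:
* `Consts.PinnedBindingAt w s y z X` — for ONE weighted graph and placement: for all weights `α, β, γ ≥ 0` in the pencil `βb + γn ≤ αζ`,
  `Ψ = αI_Z − βI_{YZᶜ} − γI_N ≥ 0` on the PINNED monotone 0/1 functionals of `C_s` implies `Ψ ≥ 0` on all monotone 0/1 functionals.  Since pinned
  functionals have `I_N = 0` and `Ψ` decreases in `γ`, this is the statement on the edge `βb + γn = αζ` of the pencil, i.e. (memo notation, `ν = μ(·|D)`)
  **`θ_all = θ_pin`**: `Φ_θ(U) = ν(U|Z) − θν(U|Y,Zᶜ) − (1−θ)ν(U|Yᶜ,Zᶜ) ≥ 0` for every up-set `U` of the cluster poset and every `θ ≤ θ_pin =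
  min over pinned U′ of ν(U′|Z)/ν(U′|Y,Zᶜ)`.  EVIDENCE: exact per-instance decision by the referee's two-vertex test (g120 §2: both refutation witnesses of
  the `∀ m` form satisfy it with `min_all = 0`; local census 473/473; kit j228409), and the gens 23–24 ratio-form censuses (14 720 + 2 400 instances, 1 920 climbs,
  0 exceptions), which tested exactly this level-zero statement.
* `Consts.PinnedBinding₀` — the conjecture: `PinnedBindingAt` at every instance.
* `Consts.crossM2_of_pinnedBindingAt` — THE REDUCTION, instance by instance: `PinnedBindingAt w s y z X` and the pinned class at this instance give the u = z CROSS
  member `M₂(X)(F) ≥ 0` for every monotone 0/1 `F` (proof = that of `crossM2_of_pinnedBinding`: `M₂ = Ψ` with `α = a_X(b+n)`, `β = a_Xζ + b_X n`,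
  `γ = a_Xζ − b_X b ≥ 0` by `Consts.crossExchange`, `βb + γn = αζ`).
* `Consts.crossM2_all_of_pinnedBindingAt` — with the pinned class supplied by the tree (`Consts.crossRel_edge_M2_of_markerPinned`): `PinnedBindingAt w s y z X`
  ALONE gives `M₂(X)(F) ≥ 0` for every monotone 0/1 `F` at that instance; `Consts.crossM2_of_pinnedBinding₀`, `Consts.crossM2_all_of_pinnedBinding₀` — the global forms.
[cite: VandenbergHaggstromKahn2005, Thm. 1.1 and its proof (pp. 3–5), Thm. 1.3 (p. 6)] [status: open]
-/

noncomputable section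

namespace Summit.CriticalPhenomena.PercolationContinuityZ3.Theorems

open MeasureTheory Set Literature.Probability.LatticeModels Literature.Probability.Percolation
open scoped Classical

namespace Consts

/-- **The pinned-binding property AT ONE INSTANCE (level zero).**  For `μ = prodBernoulli w`, owner `s`, markers `y, z`, avoided set `X`,
`D = {s↮X}`: for all weights `α, β, γ ≥ 0` with `β·μ(D∩Zᶜ∩Y) + γ·μ(D∩Zᶜ∩Yᶜ) ≤ α·μ(D∩Z)`, if
`0 ≤ α∫_{D∩Z}F − β∫_{D∩Zᶜ∩Y}F − γ∫_{D∩Zᶜ∩Yᶜ}F` for every PINNED monotone 0/1 functional `F` of the open edge cluster of `s`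
(`F(C_s) = 1 ⟹ s~y`), then the same holds for every monotone 0/1 functional (`θ_all = θ_pin` in the memos' pencil notation).
[cite: VandenbergHaggstromKahn2005, Thm. 1.3 (p. 6)] -/
def PinnedBindingAt {n : ℕ} (w : Sym2 (Fin n) → unitInterval) (s y z : Fin n) (X : Set (Fin n)) : Prop :=
  ∀ (α β γ : ℝ), 0 ≤ α → 0 ≤ β → 0 ≤ γ →
    β * (prodBernoulli w).real ({ω : BondConfig (Fin n) | ∀ x ∈ insert z X, ¬ (openGraph ω).Reachable s x} ∩ openConn s y) +
        γ * (prodBernoulli w).real {ω : BondConfig (Fin n) | (∀ x ∈ insert z X, ¬ (openGraph ω).Reachable s x) ∧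
          ¬ (openGraph ω).Reachable s y} ≤
      α * (prodBernoulli w).real ({ω : BondConfig (Fin n) | ∀ x ∈ X, ¬ (openGraph ω).Reachable s x} ∩ openConn s z) →
    (∀ F : Set (Sym2 (Fin n)) → ℝ, Monotone F → (∀ C, F C = 0 ∨ F C = 1) →
      (∀ ω : BondConfig (Fin n), F (openEdgeCluster ω s) = 1 → (openGraph ω).Reachable s y) →
      0 ≤ α * (∫ ω in {ω : BondConfig (Fin n) | ∀ x ∈ X, ¬ (openGraph ω).Reachable s x} ∩ openConn s z,
              F (openEdgeCluster ω s) ∂(prodBernoulli w)) -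
          β * (∫ ω in {ω : BondConfig (Fin n) | ∀ x ∈ insert z X, ¬ (openGraph ω).Reachable s x} ∩ openConn s y,
              F (openEdgeCluster ω s) ∂(prodBernoulli w)) -
          γ * (∫ ω in {ω : BondConfig (Fin n) | (∀ x ∈ insert z X, ¬ (openGraph ω).Reachable s x) ∧ ¬ (openGraph ω).Reachable s y},
              F (openEdgeCluster ω s) ∂(prodBernoulli w))) →
    ∀ F : Set (Sym2 (Fin n)) → ℝ, Monotone F → (∀ C, F C = 0 ∨ F C = 1) →
      0 ≤ α * (∫ ω in {ω : BondConfig (Fin n) | ∀ x ∈ X, ¬ (openGraph ω).Reachable s x} ∩ openConn s z,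
              F (openEdgeCluster ω s) ∂(prodBernoulli w)) -
          β * (∫ ω in {ω : BondConfig (Fin n) | ∀ x ∈ insert z X, ¬ (openGraph ω).Reachable s x} ∩ openConn s y,
              F (openEdgeCluster ω s) ∂(prodBernoulli w)) -
          γ * (∫ ω in {ω : BondConfig (Fin n) | (∀ x ∈ insert z X, ¬ (openGraph ω).Reachable s x) ∧ ¬ (openGraph ω).Reachable s y},
              F (openEdgeCluster ω s) ∂(prodBernoulli w))

/-- **CONJECTURE (P_pin)₀, the pinned-binding conjecture at level zero** (the repaired form of the refuted `Consts.PinnedBinding`): `Consts.PinnedBindingAt`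
holds for every finite weighted graph, owner, markers and avoided set.  Exact census: referee g120 two-vertex decision (kit j228409), gens 23–24 ratio-form
censuses (0 exceptions).  [cite: VandenbergHaggstromKahn2005, Thm. 1.3 (p. 6)] [status: open] -/
@[conjecture] def PinnedBinding₀ : Prop :=
  ∀ (n : ℕ) (w : Sym2 (Fin n) → unitInterval) (s y z : Fin n) (X : Set (Fin n)), PinnedBindingAt w s y z X

/-- **THE u = z CROSS MEMBER FROM THE INSTANCE-LOCAL BINDING PROPERTY AND THE PINNED CLASS.**  If `Consts.PinnedBindingAt w s y z X` holds and
`M₂(X)(F′) ≥ 0` for every pinned monotone 0/1 functional `F′` at this instance, then `M₂(X)(F) ≥ 0` for EVERY monotone 0/1 functional `F`: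
`0 ≤ polMargin μ s y z F (X∪z) (X∪z) X + polMargin μ s y z F (X∪z) X (X∪z) + polMargin μ s y z F X (X∪z) (X∪z)`.
[cite: VandenbergHaggstromKahn2005, Thm. 1.1 and its proof (pp. 3–5)] -/
theorem crossM2_of_pinnedBindingAt {n : ℕ} (w : Sym2 (Fin n) → unitInterval) (s y z : Fin n) (X : Set (Fin n))
    (hPB : PinnedBindingAt w s y z X)
    (hpin : ∀ F : Set (Sym2 (Fin n)) → ℝ, Monotone F → (∀ C, F C = 0 ∨ F C = 1) →
      (∀ ω : BondConfig (Fin n), F (openEdgeCluster ω s) = 1 → (openGraph ω).Reachable s y) →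
      0 ≤ polMargin (prodBernoulli w) s y z F (insert z X) (insert z X) X +
            polMargin (prodBernoulli w) s y z F (insert z X) X (insert z X) +
          polMargin (prodBernoulli w) s y z F X (insert z X) (insert z X))
    (F : Set (Sym2 (Fin n)) → ℝ) (hFm : Monotone F) (hF01 : ∀ C, F C = 0 ∨ F C = 1) :
    0 ≤ polMargin (prodBernoulli w) s y z F (insert z X) (insert z X) X +
          polMargin (prodBernoulli w) s y z F (insert z X) X (insert z X) +
        polMargin (prodBernoulli w) s y z F X (insert z X) (insert z X) := by
  set μ := prodBernoulli w with hμ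
  -- the events and cells
  set D : Set (BondConfig (Fin n)) := {ω | ∀ x ∈ X, ¬ (openGraph ω).Reachable s x} with hD
  set Dz : Set (BondConfig (Fin n)) := {ω | ∀ x ∈ insert z X, ¬ (openGraph ω).Reachable s x} with hDz
  set N : Set (BondConfig (Fin n)) := {ω | (∀ x ∈ insert z X, ¬ (openGraph ω).Reachable s x) ∧ ¬ (openGraph ω).Reachable s y} with hN
  set AX : Set (BondConfig (Fin n)) := {ω : BondConfig (Fin n) | ∀ x ∈ insert s (insert z X), ¬ (openGraph ω).Reachable y x} ∩ Dz
    with hAX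
  set BX : Set (BondConfig (Fin n)) := {ω : BondConfig (Fin n) | ∀ x ∈ insert s X, ¬ (openGraph ω).Reachable y x} ∩ D ∩ openConn y z
    with hBX
  set aX := μ.real AX with haX
  set bX := μ.real BX with hbX
  set ζ := μ.real (D ∩ openConn s z) with hζ
  set b := μ.real (Dz ∩ openConn s y) with hb
  set nn := μ.real N with hnn
  -- `M₂(X)(G) = Ψ(G)` for every functional `G`
  have hNeq : N = Dz \ openConn s y := by
    ext ω; simp only [hN, hDz, openConn, mem_setOf_eq, mem_sdiff]
  have hmDz : μ.real Dz = b + nn := by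
    rw [hb, hnn, hNeq]; exact (measureReal_inter_add_sdiff (μ := μ) (s := Dz) (MeasurableSet.of_discrete : MeasurableSet (openConn s y))).symm
  have key : ∀ G : Set (Sym2 (Fin n)) → ℝ,
      polMargin μ s y z G (insert z X) (insert z X) X + polMargin μ s y z G (insert z X) X (insert z X) +
          polMargin μ s y z G X (insert z X) (insert z X) =
        aX * (b + nn) * (∫ ω in D ∩ openConn s z, G (openEdgeCluster ω s) ∂μ) -
          (aX * ζ + bX * nn) * (∫ ω in Dz ∩ openConn s y, G (openEdgeCluster ω s) ∂μ) -
          (aX * ζ - bX * b) * (∫ ω in N, G (openEdgeCluster ω s) ∂μ) := by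
    intro G
    have hIDz : (∫ ω in Dz, G (openEdgeCluster ω s) ∂μ) =
        (∫ ω in Dz ∩ openConn s y, G (openEdgeCluster ω s) ∂μ) + ∫ ω in N, G (openEdgeCluster ω s) ∂μ := by
      rw [hNeq]; exact (integral_inter_add_sdiff (MeasurableSet.of_discrete : MeasurableSet (openConn s y)) Integrable.of_finite).symm
    unfold polMargin
    have hW : (AX ∩ openConn y z) = ∅ := by
      ext ω
      simp only [hAX, hDz, mem_inter_iff, mem_setOf_eq, forall_mem_insert, openConn, mem_empty_iff_false, iff_false]
      exact fun ⟨⟨⟨_, hyz, _⟩, _⟩, h⟩ => hyz h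
    have hZ : (Dz ∩ openConn s z) = ∅ := by
      ext ω
      simp only [hDz, mem_inter_iff, mem_setOf_eq, forall_mem_insert, openConn, mem_empty_iff_false, iff_false]
      exact fun ⟨⟨hsz, _⟩, h⟩ => hsz h
    simp only [← hD, ← hDz] at hW hZ ⊢
    rw [show ({ω : BondConfig (Fin n) | ∀ x ∈ insert s (insert z X), ¬ (openGraph ω).Reachable y x} ∩ Dz) = AX from rfl] at *
    rw [hW, hZ, hIDz, hmDz]
    simp only [measureReal_empty, Measure.restrict_empty, integral_zero_measure]
    ring
  -- `γ ≥ 0`: the cross-conditioning exchange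
  have hγ : bX * b ≤ aX * ζ := by
    have hx := crossExchange w s y z X X
    have e1 : {ω : BondConfig (Fin n) | (openGraph ω).Reachable y z ∧ ¬ (openGraph ω).Reachable y s ∧
        (∀ x ∈ X, ¬ (openGraph ω).Reachable y x) ∧ (∀ x ∈ X, ¬ (openGraph ω).Reachable s x)} = BX := by
      ext ω
      simp only [hBX, hD, openConn, mem_inter_iff, mem_setOf_eq, forall_mem_insert]
      tauto
    have e2 : {ω : BondConfig (Fin n) | (openGraph ω).Reachable s y ∧ ¬ (openGraph ω).Reachable s z ∧
        (∀ x ∈ X, ¬ (openGraph ω).Reachable s x)} = Dz ∩ openConn s y := by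
      ext ω
      simp only [hDz, openConn, mem_inter_iff, mem_setOf_eq, forall_mem_insert]
      tauto
    have e3 : {ω : BondConfig (Fin n) | ¬ (openGraph ω).Reachable y s ∧ ¬ (openGraph ω).Reachable y z ∧
        ¬ (openGraph ω).Reachable s z ∧ (∀ x ∈ X ∪ X, ¬ (openGraph ω).Reachable y x) ∧
        (∀ x ∈ X ∪ X, ¬ (openGraph ω).Reachable s x)} = AX := by
      ext ω
      simp only [hAX, hDz, union_self, mem_inter_iff, mem_setOf_eq, forall_mem_insert]
      tauto
    have e4 : (prodBernoulli w).real {ω : BondConfig (Fin n) | (openGraph ω).Reachable s y ∧ (openGraph ω).Reachable s z ∧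
        (∀ x ∈ X ∩ X, ¬ (openGraph ω).Reachable s x)} ≤ ζ := by
      refine measureReal_mono (fun ω hω => ?_)
      simp only [inter_self, mem_setOf_eq] at hω
      exact ⟨fun x hx => hω.2.2 x hx, hω.2.1⟩
    rw [e1, e2, e3] at hx
    calc bX * b = (prodBernoulli w).real BX * (prodBernoulli w).real (Dz ∩ openConn s y) := by rw [hbX, hb]
      _ ≤ (prodBernoulli w).real AX * (prodBernoulli w).real {ω : BondConfig (Fin n) | (openGraph ω).Reachable s y ∧
            (openGraph ω).Reachable s z ∧ (∀ x ∈ X ∩ X, ¬ (openGraph ω).Reachable s x)} := hx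
      _ ≤ aX * ζ := by rw [haX]; exact mul_le_mul_of_nonneg_left e4 measureReal_nonneg
  -- apply the instance-local binding property with the weights of `M₂`
  have h := hPB (aX * (b + nn)) (aX * ζ + bX * nn) (aX * ζ - bX * b)
    (mul_nonneg measureReal_nonneg (add_nonneg measureReal_nonneg measureReal_nonneg))
    (add_nonneg (mul_nonneg measureReal_nonneg measureReal_nonneg) (mul_nonneg measureReal_nonneg measureReal_nonneg))
    (sub_nonneg.2 hγ) (le_of_eq (by rw [← hb, ← hnn, ← hζ]; ring))
    (fun G hGm hG01 hGY => by rw [← key G]; exact hpin G hGm hG01 hGY) F hFm hF01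
  rw [key F]
  exact h

/-- **(P_pin)₀ AT AN INSTANCE ⟹ the u = z CROSS member `M₂(X)(F) ≥ 0` for every monotone 0/1 functional AT THAT INSTANCE** — the pinned class is supplied by
the tree (`Consts.crossRel_edge_M2_of_markerPinned`).  [cite: VandenbergHaggstromKahn2005, Thm. 1.1 (pp. 3–5)] -/
theorem crossM2_all_of_pinnedBindingAt {n : ℕ} (w : Sym2 (Fin n) → unitInterval) (s y z : Fin n) (X : Set (Fin n))
    (hPB : PinnedBindingAt w s y z X) (F : Set (Sym2 (Fin n)) → ℝ) (hFm : Monotone F) (hF01 : ∀ C, F C = 0 ∨ F C = 1) :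
    0 ≤ polMargin (prodBernoulli w) s y z F (insert z X) (insert z X) X +
          polMargin (prodBernoulli w) s y z F (insert z X) X (insert z X) +
        polMargin (prodBernoulli w) s y z F X (insert z X) (insert z X) :=
  crossM2_of_pinnedBindingAt w s y z X hPB (fun G hGm hG01 hGY => crossRel_edge_M2_of_markerPinned w s y z X G hGm hG01 hGY) F hFm hF01

/-- **THE u = z CROSS MEMBER FOLLOWS FROM (P_pin)₀ AND THE PINNED CLASS** (global form of `crossM2_of_pinnedBindingAt`; replaces
`Consts.crossM2_of_pinnedBinding`, whose hypothesis `Consts.PinnedBinding` is refuted).  [cite: VandenbergHaggstromKahn2005, Thm. 1.1 (pp. 3–5)] -/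
theorem crossM2_of_pinnedBinding₀ (hPB : PinnedBinding₀) {n : ℕ} (w : Sym2 (Fin n) → unitInterval) (s y z : Fin n) (X : Set (Fin n))
    (hpin : ∀ F : Set (Sym2 (Fin n)) → ℝ, Monotone F → (∀ C, F C = 0 ∨ F C = 1) →
      (∀ ω : BondConfig (Fin n), F (openEdgeCluster ω s) = 1 → (openGraph ω).Reachable s y) →
      0 ≤ polMargin (prodBernoulli w) s y z F (insert z X) (insert z X) X +
            polMargin (prodBernoulli w) s y z F (insert z X) X (insert z X) +
          polMargin (prodBernoulli w) s y z F X (insert z X) (insert z X))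
    (F : Set (Sym2 (Fin n)) → ℝ) (hFm : Monotone F) (hF01 : ∀ C, F C = 0 ∨ F C = 1) :
    0 ≤ polMargin (prodBernoulli w) s y z F (insert z X) (insert z X) X +
          polMargin (prodBernoulli w) s y z F (insert z X) X (insert z X) +
        polMargin (prodBernoulli w) s y z F X (insert z X) (insert z X) :=
  crossM2_of_pinnedBindingAt w s y z X (hPB n w s y z X) hpin F hFm hF01

/-- **(P_pin)₀ ⟹ the u = z CROSS member `M₂(X)(F) ≥ 0` for every monotone 0/1 functional, everywhere** (replaces `Consts.crossM2_all_of_pinnedBinding`).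
[cite: VandenbergHaggstromKahn2005, Thm. 1.1 (pp. 3–5)] -/
theorem crossM2_all_of_pinnedBinding₀ (hPB : PinnedBinding₀) {n : ℕ} (w : Sym2 (Fin n) → unitInterval) (s y z : Fin n) (X : Set (Fin n))
    (F : Set (Sym2 (Fin n)) → ℝ) (hFm : Monotone F) (hF01 : ∀ C, F C = 0 ∨ F C = 1) :
    0 ≤ polMargin (prodBernoulli w) s y z F (insert z X) (insert z X) X +
          polMargin (prodBernoulli w) s y z F (insert z X) X (insert z X) +
        polMargin (prodBernoulli w) s y z F X (insert z X) (insert z X) :=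
  crossM2_all_of_pinnedBindingAt w s y z X (hPB n w s y z X) F hFm hF01

end Consts

end Summit.CriticalPhenomena.PercolationContinuityZ3.Theorems

end
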